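import Literature.Computability.MetaComplexity.EFSub
import Literature.Computability.MetaComplexity.EFLogic
import HarnessLib

/-!
# Order laws in extended Frege: comparison by the complement adder

Layer C/4 of the `EF`-proof construction kit: the laws of the strict comparison `x < y`,
represented by the literal `¬ge` of a subtractor/comparator instance `x + ¬y + 1`
(`EFSub.lean`), as polynomial-size blocks over views; every law is one induction along the
positions with an invariant on the carries, propagated by one constant-size sound rule
(`Sub.orderRules`, the two largest verified by `FregeRule.checkD`).

## Content

* `Sub.View.Avail.congr`; `Sub.isBlock_leibLines`: congruence of subtractors/comparators.
* `Sub.TransData.isBlock_lines`: transitivity `x < y → y < z → x < z`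
  (invariant `ge₁ᵢ ∨ ge₂ᵢ ∨ ¬ge₃ᵢ`).
* `Sub.MonoData.isBlock_mono` / `isBlock_monoRev`: `x < y ↔ x + z < y + z`
  (invariant `monoF` relating the comparison carries with the carries of the two adders).
* `Sub.GeData.isBlock_lines`: `x + z ≥ z` (invariant `δᵢ ↔ ¬cᵢ`).
* `Sub.isBlock_topBit`: under `x < y` with the top bit of `y` false, the top bit of `x` is
  false and the low parts compare strictly.

## Sources

* S. A. Cook, R. A. Reckhow, *The relative efficiency of propositional proof systems*,
  J. Symbolic Logic 44 (1979), §2 (sound schematic rules).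
* S. R. Buss, *Bounded Arithmetic* (1986); J. Krajíček, *Bounded Arithmetic, Propositional
  Logic, and Complexity Theory* (1995), §9.2 (the laws of discretely ordered arithmetic on
  binary numerals have polynomial-size `EF` proofs; constructed here directly).
-/

namespace Literature.Computability.MetaComplexity

open _root_.Computability Complexity Complexity.PropForm Netlist

namespace Sub

variable {G : FregeSystem} {K : PropForm ℕ} {Γ : Set (PropForm ℕ)} {w : ℕ}

/-- Availability of a subtractor view transfers along pointwise equal operand functions and
equal bases. [folklore] -/
theorem View.Avail.congr {S S' : View} {K : PropForm ℕ} {Γ : Set (PropForm ℕ)} {w : ℕ}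
    (h : S.Avail K Γ w) (hb : S'.base = S.base) (hx : ∀ i < w, S'.x i = S.x i)
    (hy : ∀ i < w, S'.y i = S.y i) : S'.Avail K Γ w := by
  obtain ⟨b, x, y⟩ := S
  obtain ⟨b', x', y'⟩ := S'
  simp only at hb hx hy
  subst hb
  refine ⟨fun j hj => ?_, h.2.congr rfl hx fun i _ => rfl⟩
  have := h.1 j hj
  simp only [View.notDef, View.ny] at this ⊢
  rw [hy j hj]
  exact this

/-! ### Rules of the order layer -/

/-- The transitivity invariant `ge₁ ∨ ge₂ ∨ ¬ge₃`. [folklore] -/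
def transF (g₁ g₂ g₃ : PropForm ℕ) : PropForm ℕ := disj g₁ (disj g₂ (neg g₃))

/-- Base of transitivity: `ge₁(0) = ⊤`. [cite: CookReckhow1979, §2 (sound rule)] -/
def rTransBase : FregeRule :=
  ⟨[ctx (var 0) (biimp (var 1) (const true))], ctx (var 0) (transF (var 1) (var 2) (var 3))⟩

/-- Step of transitivity (free: `g₁ g₂ g₃ x y z` = 1–6; defined: complements `n₁ n₂ n₃` = 7–9,
next carries = 10–12). [cite: CookReckhow1979, §2 (sound rule)] -/
def rTransStep : FregeRule :=
  ⟨[ctx (var 0) (transF (var 1) (var 2) (var 3)),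
    ctx (var 0) (biimp (var 7) (neg (var 5))), ctx (var 0) (biimp (var 8) (neg (var 6))),
    ctx (var 0) (biimp (var 9) (neg (var 6))),
    ctx (var 0) (biimp (var 10) (majF (var 4) (var 7) (var 1))),
    ctx (var 0) (biimp (var 11) (majF (var 5) (var 8) (var 2))),
    ctx (var 0) (biimp (var 12) (majF (var 4) (var 9) (var 3)))],
   ctx (var 0) (transF (var 10) (var 11) (var 12))⟩

/-- End of transitivity: `x < y`, `y < z` give `x < z`. [cite: CookReckhow1979, §2 (sound rule)] -/
def rTransEnd : FregeRule :=
  ⟨[ctx (var 0) (transF (var 1) (var 2) (var 3)), ctx (var 0) (neg (var 1)), ctx (var 0) (neg (var 2))],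
   ctx (var 0) (neg (var 3))⟩

/-- The monotonicity invariant relating the comparison carry `α` of `x` vs `y`, the carries
`p, q` of `x + z`, `y + z`, and the comparison carry `δ` of `x + z` vs `y + z`:
`(δ ↔ ((p ↔ q) ∧ α) ∨ (¬p ∧ q)) ∧ (α ∨ ¬p ∨ q) ∧ (¬α ∨ ¬q ∨ p)`. [folklore] -/
def monoF (α p q δ : PropForm ℕ) : PropForm ℕ :=
  conj (biimp δ (disj (conj (biimp p q) α) (conj (neg p) q)))
    (conj (disj α (disj (neg p) q)) (disj (neg α) (disj (neg q) p)))

/-- Base of monotonicity. [cite: CookReckhow1979, §2 (sound rule)] -/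
def rMonoBase : FregeRule :=
  ⟨[ctx (var 0) (biimp (var 1) (const true)), ctx (var 0) (biimp (var 2) (const false)),
    ctx (var 0) (biimp (var 3) (const false)), ctx (var 0) (biimp (var 4) (const true))],
   ctx (var 0) (monoF (var 1) (var 2) (var 3) (var 4))⟩

/-- Step of monotonicity (free: `α p q δ` = 1–4, `x y z` = 5–7; defined: `ny` = 8, `α'` = 9,
`p'` = 10, `q'` = 11, `sP` = 12, `sQ` = 13, `nt` = 14, `δ'` = 15).
[cite: CookReckhow1979, §2 (sound rule)] -/
def rMonoStep : FregeRule :=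
  ⟨[ctx (var 0) (monoF (var 1) (var 2) (var 3) (var 4)),
    ctx (var 0) (biimp (var 8) (neg (var 6))),
    ctx (var 0) (biimp (var 9) (majF (var 5) (var 8) (var 1))),
    ctx (var 0) (biimp (var 10) (majF (var 5) (var 7) (var 2))),
    ctx (var 0) (biimp (var 11) (majF (var 6) (var 7) (var 3))),
    ctx (var 0) (biimp (var 12) (xor3F (var 5) (var 7) (var 2))),
    ctx (var 0) (biimp (var 13) (xor3F (var 6) (var 7) (var 3))),
    ctx (var 0) (biimp (var 14) (neg (var 13))),
    ctx (var 0) (biimp (var 15) (majF (var 12) (var 14) (var 4)))],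
   ctx (var 0) (monoF (var 9) (var 10) (var 11) (var 15))⟩

/-- End of monotonicity, forward: `x < y` gives `x + z < y + z` (free: `α p q δ` = 1–4;
defined `nt` = 5, `δ'` = 6). [cite: CookReckhow1979, §2 (sound rule)] -/
def rMonoEnd : FregeRule :=
  ⟨[ctx (var 0) (monoF (var 1) (var 2) (var 3) (var 4)), ctx (var 0) (neg (var 1)),
    ctx (var 0) (biimp (var 5) (neg (var 3))), ctx (var 0) (biimp (var 6) (majF (var 2) (var 5) (var 4)))],
   ctx (var 0) (neg (var 6))⟩

/-- End of monotonicity, backward: `x + z < y + z` gives `x < y`.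
[cite: CookReckhow1979, §2 (sound rule)] -/
def rMonoRev : FregeRule :=
  ⟨[ctx (var 0) (monoF (var 1) (var 2) (var 3) (var 4)),
    ctx (var 0) (biimp (var 5) (neg (var 3))), ctx (var 0) (biimp (var 6) (majF (var 2) (var 5) (var 4))),
    ctx (var 0) (neg (var 6))],
   ctx (var 0) (neg (var 1))⟩

/-- Base of `x + z ≥ z`: `δ₀ = ⊤`, `p₀ = ⊥`. [cite: CookReckhow1979, §2 (sound rule)] -/
def rGeBase : FregeRule :=
  ⟨[ctx (var 0) (biimp (var 1) (const true)), ctx (var 0) (biimp (var 2) (const false))],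
   ctx (var 0) (biimp (var 1) (neg (var 2)))⟩

/-- Step of `x + z ≥ z` (free: `δ p x z` = 1–4; defined `sP` = 5, `nz` = 6, `δ'` = 7, `p'` = 8):
the invariant `δ ↔ ¬p` propagates. [cite: CookReckhow1979, §2 (sound rule)] -/
def rGeStep : FregeRule :=
  ⟨[ctx (var 0) (biimp (var 1) (neg (var 2))),
    ctx (var 0) (biimp (var 5) (xor3F (var 3) (var 4) (var 2))),
    ctx (var 0) (biimp (var 6) (neg (var 4))),
    ctx (var 0) (biimp (var 7) (majF (var 5) (var 6) (var 1))),
    ctx (var 0) (biimp (var 8) (majF (var 3) (var 4) (var 2)))],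
   ctx (var 0) (biimp (var 7) (neg (var 8)))⟩

/-- Top of `x + z ≥ z`: the last comparison carry is `⊤` (free `δ p f` = 1–3; defined `nf` = 4,
`δ'` = 5). [cite: CookReckhow1979, §2 (sound rule)] -/
def rGeTop : FregeRule :=
  ⟨[ctx (var 0) (biimp (var 1) (neg (var 2))), ctx (var 0) (neg (var 3)),
    ctx (var 0) (biimp (var 4) (neg (var 3))), ctx (var 0) (biimp (var 5) (majF (var 2) (var 4) (var 1)))],
   ctx (var 0) (var 5)⟩

/-- Top bit of a strict comparison with a zero-extended operand: from `¬yw`, `n ↔ ¬yw`,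
`g' ↔ maj(xw, n, g)`, `¬g'` infer `¬xw`. [cite: CookReckhow1979, §2 (sound rule)] -/
def rTopBit : FregeRule :=
  ⟨[ctx (var 0) (neg (var 1)), ctx (var 0) (biimp (var 2) (neg (var 1))),
    ctx (var 0) (biimp (var 3) (majF (var 4) (var 2) (var 5))), ctx (var 0) (neg (var 3))],
   ctx (var 0) (neg (var 4))⟩

/-- … and `¬g` (the low parts compare strictly as well). [cite: CookReckhow1979, §2 (sound rule)] -/
def rTopGe : FregeRule :=
  ⟨[ctx (var 0) (neg (var 1)), ctx (var 0) (biimp (var 2) (neg (var 1))),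
    ctx (var 0) (biimp (var 3) (majF (var 4) (var 2) (var 5))), ctx (var 0) (neg (var 3))],
   ctx (var 0) (neg (var 5))⟩

/-- The rules of the order layer. [cite: CookReckhow1979, §2] -/
def orderRules : List FregeRule :=
  [rTransBase, rTransStep, rTransEnd, rMonoBase, rMonoStep, rMonoEnd, rMonoRev, rGeBase, rGeStep,
    rGeTop, rTopBit, rTopGe]

/-- Soundness check of `rTransStep`. [cite: CookReckhow1979, §2 (sound rule)] -/
theorem checkD_rTransStep : rTransStep.checkD 7
    [(7, neg (var 5)), (8, neg (var 6)), (9, neg (var 6)), (10, majF (var 4) (var 7) (var 1)),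
      (11, majF (var 5) (var 8) (var 2)), (12, majF (var 4) (var 9) (var 3))] = true := by
  decide +kernel

/-- Soundness check of `rMonoStep`. [cite: CookReckhow1979, §2 (sound rule)] -/
theorem checkD_rMonoStep : rMonoStep.checkD 8
    [(8, neg (var 6)), (9, majF (var 5) (var 8) (var 1)), (10, majF (var 5) (var 7) (var 2)),
      (11, majF (var 6) (var 7) (var 3)), (12, xor3F (var 5) (var 7) (var 2)),
      (13, xor3F (var 6) (var 7) (var 3)), (14, neg (var 13)), (15, majF (var 12) (var 14) (var 4))] =
      true := by
  decide +kernel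

/-- Every rule of the order layer is sound. [cite: CookReckhow1979, §2 (sound rule)] -/
theorem isSound_of_mem_orderRules : ∀ r ∈ orderRules, r.IsSound := by
  intro r hr
  simp only [orderRules, List.mem_cons, List.not_mem_nil, or_false] at hr
  rcases hr with rfl | rfl | rfl | rfl | rfl | rfl | rfl | rfl | rfl | rfl | rfl | rfl
  · exact FregeRule.isSound_of_check (by decide +kernel)
  · exact FregeRule.isSound_of_checkD checkD_rTransStep
  · exact FregeRule.isSound_of_check (by decide +kernel)
  · exact FregeRule.isSound_of_check (by decide +kernel)
  · exact FregeRule.isSound_of_checkD checkD_rMonoStep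
  · exact FregeRule.isSound_of_check (by decide +kernel)
  · exact FregeRule.isSound_of_check (by decide +kernel)
  · exact FregeRule.isSound_of_check (by decide +kernel)
  · exact FregeRule.isSound_of_check (by decide +kernel)
  · exact FregeRule.isSound_of_check (by decide +kernel)
  · exact FregeRule.isSound_of_check (by decide +kernel)
  · exact FregeRule.isSound_of_check (by decide +kernel)

/-- Membership in `orderRules`. [folklore] -/
theorem mem_orderRules :
    rTransBase ∈ orderRules ∧ rTransStep ∈ orderRules ∧ rTransEnd ∈ orderRules ∧
      rMonoBase ∈ orderRules ∧ rMonoStep ∈ orderRules ∧ rMonoEnd ∈ orderRules ∧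
      rMonoRev ∈ orderRules ∧ rGeBase ∈ orderRules ∧ rGeStep ∈ orderRules ∧ rGeTop ∈ orderRules ∧
      rTopBit ∈ orderRules ∧ rTopGe ∈ orderRules := by
  simp [orderRules]

/-! ### Law: transitivity of `<` -/

/-- The three comparators of transitivity: `S₁ = (x, y)`, `S₂ = (y, z)`, `S₃ = (x, z)`.
[folklore] -/
structure TransData where
  /-- base of the comparator of `x, y` -/
  b₁ : ℕ
  /-- base of the comparator of `y, z` -/
  b₂ : ℕ
  /-- base of the comparator of `x, z` -/
  b₃ : ℕ
  /-- first word -/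
  x : ℕ → ℕ
  /-- second word -/
  y : ℕ → ℕ
  /-- third word -/
  z : ℕ → ℕ
  /-- width -/
  w : ℕ

namespace TransData

/-- `S₁` compares `x` with `y`. [folklore] -/
def S₁ (d : TransData) : View := ⟨d.b₁, d.x, d.y⟩
/-- `S₂` compares `y` with `z`. [folklore] -/
def S₂ (d : TransData) : View := ⟨d.b₂, d.y, d.z⟩
/-- `S₃` compares `x` with `z`. [folklore] -/
def S₃ (d : TransData) : View := ⟨d.b₃, d.x, d.z⟩

/-- The lines: the invariant `ge₁ᵢ ∨ ge₂ᵢ ∨ ¬ge₃ᵢ` for `i ≤ w`, then `¬ge₃(w)` (`x < z`).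
[folklore] -/
def line (d : TransData) (K : PropForm ℕ) (k : ℕ) : PropForm ℕ :=
  if k = d.w + 1 then ctx K (neg (var (d.S₃.ge d.w d.w)))
  else ctx K (transF (var (d.S₁.ge d.w k)) (var (d.S₂.ge d.w k)) (var (d.S₃.ge d.w k)))

/-- The block of transitivity. [folklore] -/
def lines (d : TransData) (K : PropForm ℕ) : List (PropForm ℕ) := (List.range (d.w + 2)).map (d.line K)

/-- Invariant positions. [folklore] -/
theorem line_inv (d : TransData) (K : PropForm ℕ) {k : ℕ} (hk : k ≤ d.w) : d.line K k =
    ctx K (transF (var (d.S₁.ge d.w k)) (var (d.S₂.ge d.w k)) (var (d.S₃.ge d.w k))) := by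
  rw [line, if_neg (by omega)]

/-- **Transitivity of strict comparison inside Frege**: from `x < y` (`¬ge` of `S₁`) and
`y < z` (`¬ge` of `S₂`) infer `x < z` (`¬ge` of `S₃`), by the invariant
`ge₁ᵢ ∨ ge₂ᵢ ∨ ¬ge₃ᵢ` along the positions. [cite: CookReckhow1979, §2] -/
theorem isBlock_lines (hG : ∀ r ∈ orderRules, r ∈ G.rules) (d : TransData) (hS₁ : d.S₁.Avail K Γ d.w)
    (hS₂ : d.S₂.Avail K Γ d.w) (hS₃ : d.S₃.Avail K Γ d.w)
    (h₁ : ctx K (neg (var (d.S₁.ge d.w d.w))) ∈ Γ) (h₂ : ctx K (neg (var (d.S₂.ge d.w d.w))) ∈ Γ) :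
    G.IsBlock Γ (d.lines K) := by
  refine isBlock_map_range (d.w + 2) fun k hk => Or.inr ?_
  by_cases hend : k = d.w + 1
  · subst hend
    rw [line, if_pos rfl]
    exact FregeSystem.IsInferredFrom.of_rule (hG _ mem_orderRules.2.2.1)
      (FregeSystem.sub [K, var (d.S₁.ge d.w d.w), var (d.S₂.ge d.w d.w), var (d.S₃.ge d.w d.w)]) rfl
      (FregeSystem.prems_cons (Or.inr ⟨d.w, by omega, (d.line_inv K le_rfl).symm⟩)
        (FregeSystem.prems_cons (Or.inl h₁) (FregeSystem.prems_cons (Or.inl h₂) FregeSystem.prems_nil)))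
  rcases k with _ | k
  · rw [d.line_inv K (Nat.zero_le _)]
    exact FregeSystem.IsInferredFrom.of_rule (hG _ mem_orderRules.1)
      (FregeSystem.sub [K, var (d.S₁.ge d.w 0), var (d.S₂.ge d.w 0), var (d.S₃.ge d.w 0)]) rfl
      (FregeSystem.prems_cons (Or.inl hS₁.2.1) FregeSystem.prems_nil)
  · have hk' : k < d.w := by omega
    rw [d.line_inv K (by omega)]
    exact FregeSystem.IsInferredFrom.of_rule (hG _ mem_orderRules.2.1)
      (FregeSystem.sub [K, var (d.S₁.ge d.w k), var (d.S₂.ge d.w k), var (d.S₃.ge d.w k), var (d.x k),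
        var (d.y k), var (d.z k), var (d.S₁.ny k), var (d.S₂.ny k), var (d.S₃.ny k),
        var (d.S₁.ge d.w (k + 1)), var (d.S₂.ge d.w (k + 1)), var (d.S₃.ge d.w (k + 1))]) rfl
      (FregeSystem.prems_cons (Or.inr ⟨k, by omega, (d.line_inv K hk'.le).symm⟩)
        (FregeSystem.prems_cons (Or.inl (hS₁.1 k hk')) (FregeSystem.prems_cons (Or.inl (hS₂.1 k hk'))
        (FregeSystem.prems_cons (Or.inl (hS₃.1 k hk')) (FregeSystem.prems_cons (Or.inl (hS₁.2.2 k hk').2)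
        (FregeSystem.prems_cons (Or.inl (hS₂.2.2 k hk').2) (FregeSystem.prems_cons (Or.inl (hS₃.2.2 k hk').2)
        FregeSystem.prems_nil)))))))

/-- Conclusion of transitivity: `x < z`. [folklore] -/
theorem mem_lines (d : TransData) (K : PropForm ℕ) : ctx K (neg (var (d.S₃.ge d.w d.w))) ∈ d.lines K := by
  have := mem_map_range (line := d.line K) (show d.w + 1 < d.w + 2 by omega)
  rwa [line, if_pos rfl] at this

/-- Size of transitivity. [folklore] -/
theorem proofSize_lines (d : TransData) (K : PropForm ℕ) :
    proofSize (d.lines K) ≤ (d.w + 2) * (K.size + 8) :=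
  proofSize_map_range_le fun k _ => by
    unfold line
    split_ifs <;> simp [ctx, transF, size]

end TransData

/-! ### Law: monotonicity of addition in both directions -/

/-- The data of monotonicity: the comparator `S = (x, y)`, the adders `P = x + z`, `Q = y + z`,
and the comparator `T = (P, Q)` of their `w+1`-bit outputs. [folklore] -/
structure MonoData where
  /-- base of `S` -/
  bS : ℕ
  /-- base of `P` -/
  bP : ℕ
  /-- base of `Q` -/
  bQ : ℕ
  /-- base of `T` -/
  bT : ℕ
  /-- first word -/
  x : ℕ → ℕ
  /-- second word -/
  y : ℕ → ℕ
  /-- the word added to both -/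
  z : ℕ → ℕ
  /-- width -/
  w : ℕ

namespace MonoData

/-- `S` compares `x` with `y`. [folklore] -/
def S (d : MonoData) : View := ⟨d.bS, d.x, d.y⟩
/-- `P = x + z`. [folklore] -/
def P (d : MonoData) : Adder.View := ⟨d.bP, d.x, d.z⟩
/-- `Q = y + z`. [folklore] -/
def Q (d : MonoData) : Adder.View := ⟨d.bQ, d.y, d.z⟩
/-- `T` compares `x + z` with `y + z` (`w + 1` bits). [folklore] -/
def T (d : MonoData) : View := ⟨d.bT, Adder.extOut d.P d.w, Adder.extOut d.Q d.w⟩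

/-- The invariant line at position `i ≤ w`. [folklore] -/
def line (d : MonoData) (K : PropForm ℕ) (i : ℕ) : PropForm ℕ :=
  ctx K (monoF (var (d.S.ge d.w i)) (var (d.P.c i)) (var (d.Q.c i)) (var (d.T.ge (d.w + 1) i)))

/-- The invariant block (positions `0 … w`). [folklore] -/
def lines (d : MonoData) (K : PropForm ℕ) : List (PropForm ℕ) := (List.range (d.w + 1)).map (d.line K)

/-- **The monotonicity invariant inside Frege**: for all positions `i ≤ w` the carries of
`S`, `P`, `Q`, `T` satisfy `monoF`. [cite: CookReckhow1979, §2] -/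
theorem isBlock_lines (hG : ∀ r ∈ orderRules, r ∈ G.rules) (d : MonoData) (hS : d.S.Avail K Γ d.w)
    (hP : d.P.Avail K Γ false d.w) (hQ : d.Q.Avail K Γ false d.w) (hT : d.T.Avail K Γ (d.w + 1)) :
    G.IsBlock Γ (d.lines K) := by
  refine isBlock_map_range (d.w + 1) fun k hk => Or.inr ?_
  rcases k with _ | k
  · exact FregeSystem.IsInferredFrom.of_rule (hG _ mem_orderRules.2.2.2.1)
      (FregeSystem.sub [K, var (d.S.ge d.w 0), var (d.P.c 0), var (d.Q.c 0), var (d.T.ge (d.w + 1) 0)]) rfl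
      (FregeSystem.prems_cons (Or.inl hS.2.1) (FregeSystem.prems_cons (Or.inl hP.1)
        (FregeSystem.prems_cons (Or.inl hQ.1) (FregeSystem.prems_cons (Or.inl hT.2.1) FregeSystem.prems_nil))))
  · have hk' : k < d.w := by omega
    have hnt := hT.1 k (by omega)
    have hct := (hT.2.2 k (by omega)).2
    rw [View.notDef, show d.T.y k = d.Q.s k from Adder.extOut_lt d.Q hk'] at hnt
    rw [Adder.View.carryDef, show (d.T.adder (d.w + 1)).x k = d.P.s k from Adder.extOut_lt d.P hk']
      at hct
    exact FregeSystem.IsInferredFrom.of_rule (hG _ mem_orderRules.2.2.2.2.1)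
      (FregeSystem.sub [K, var (d.S.ge d.w k), var (d.P.c k), var (d.Q.c k), var (d.T.ge (d.w + 1) k),
        var (d.x k), var (d.y k), var (d.z k), var (d.S.ny k), var (d.S.ge d.w (k + 1)),
        var (d.P.c (k + 1)), var (d.Q.c (k + 1)), var (d.P.s k), var (d.Q.s k), var (d.T.ny k),
        var (d.T.ge (d.w + 1) (k + 1))]) rfl
      (FregeSystem.prems_cons (Or.inr ⟨k, by omega, rfl⟩)
        (FregeSystem.prems_cons (Or.inl (hS.1 k hk')) (FregeSystem.prems_cons (Or.inl (hS.2.2 k hk').2)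
        (FregeSystem.prems_cons (Or.inl (hP.2 k hk').2) (FregeSystem.prems_cons (Or.inl (hQ.2 k hk').2)
        (FregeSystem.prems_cons (Or.inl (hP.2 k hk').1) (FregeSystem.prems_cons (Or.inl (hQ.2 k hk').1)
        (FregeSystem.prems_cons (Or.inl hnt) (FregeSystem.prems_cons (Or.inl hct)
        FregeSystem.prems_nil)))))))))

/-- The invariant at position `i ≤ w` is in the block. [folklore] -/
theorem mem_lines (d : MonoData) (K : PropForm ℕ) {i : ℕ} (hi : i ≤ d.w) : d.line K i ∈ d.lines K :=
  mem_map_range (by omega)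

/-- Size of the invariant block. [folklore] -/
theorem proofSize_lines (d : MonoData) (K : PropForm ℕ) :
    proofSize (d.lines K) ≤ (d.w + 1) * (K.size + 55) :=
  proofSize_map_range_le fun k _ => by simp [line, ctx, monoF, size, FregeSystem.size_biimp]

/-- The top definitions of `T` in normal form: its complement gate and carry gate at position
`w` read the carry-outs of `P` and `Q`. [folklore] -/
theorem avail_top {d : MonoData} (hT : d.T.Avail K Γ (d.w + 1)) :
    ctx K (biimp (var (d.T.ny d.w)) (neg (var (d.Q.c d.w)))) ∈ Γ ∧
      ctx K (biimp (var (d.T.ge (d.w + 1) (d.w + 1)))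
        (majF (var (d.P.c d.w)) (var (d.T.ny d.w)) (var (d.T.ge (d.w + 1) d.w)))) ∈ Γ := by
  have hnt := hT.1 d.w (Nat.lt_succ_self _)
  have hct := (hT.2.2 d.w (Nat.lt_succ_self _)).2
  rw [View.notDef, show d.T.y d.w = d.Q.c d.w from Adder.extOut_top d.Q d.w] at hnt
  rw [Adder.View.carryDef, show (d.T.adder (d.w + 1)).x d.w = d.P.c d.w from Adder.extOut_top d.P d.w]
    at hct
  exact ⟨hnt, hct⟩

/-- **Monotonicity of addition inside Frege**: `x < y` gives `x + z < y + z` — one inference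
from the invariant at `w`, appended to the invariant block. [cite: CookReckhow1979, §2] -/
theorem isBlock_mono (hG : ∀ r ∈ orderRules, r ∈ G.rules) (d : MonoData) (hS : d.S.Avail K Γ d.w)
    (hP : d.P.Avail K Γ false d.w) (hQ : d.Q.Avail K Γ false d.w) (hT : d.T.Avail K Γ (d.w + 1))
    (hlt : ctx K (neg (var (d.S.ge d.w d.w))) ∈ Γ) :
    G.IsBlock Γ (d.lines K ++ [ctx K (neg (var (d.T.ge (d.w + 1) (d.w + 1))))]) := by
  refine (d.isBlock_lines hG hS hP hQ hT).snoc (Or.inr ?_)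
  obtain ⟨hnt, hct⟩ := avail_top hT
  exact FregeSystem.IsInferredFrom.of_rule (hG _ mem_orderRules.2.2.2.2.2.1)
    (FregeSystem.sub [K, var (d.S.ge d.w d.w), var (d.P.c d.w), var (d.Q.c d.w), var (d.T.ge (d.w + 1) d.w),
      var (d.T.ny d.w), var (d.T.ge (d.w + 1) (d.w + 1))]) rfl
    (FregeSystem.prems_cons (Or.inr (d.mem_lines K le_rfl)) (FregeSystem.prems_cons (Or.inl hlt)
      (FregeSystem.prems_cons (Or.inl hnt) (FregeSystem.prems_cons (Or.inl hct) FregeSystem.prems_nil))))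

/-- **Cancellation of addition in a strict comparison inside Frege**: `x + z < y + z` gives
`x < y`. [cite: CookReckhow1979, §2] -/
theorem isBlock_monoRev (hG : ∀ r ∈ orderRules, r ∈ G.rules) (d : MonoData) (hS : d.S.Avail K Γ d.w)
    (hP : d.P.Avail K Γ false d.w) (hQ : d.Q.Avail K Γ false d.w) (hT : d.T.Avail K Γ (d.w + 1))
    (hlt : ctx K (neg (var (d.T.ge (d.w + 1) (d.w + 1)))) ∈ Γ) :
    G.IsBlock Γ (d.lines K ++ [ctx K (neg (var (d.S.ge d.w d.w)))]) := by
  refine (d.isBlock_lines hG hS hP hQ hT).snoc (Or.inr ?_)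
  obtain ⟨hnt, hct⟩ := avail_top hT
  exact FregeSystem.IsInferredFrom.of_rule (hG _ mem_orderRules.2.2.2.2.2.2.1)
    (FregeSystem.sub [K, var (d.S.ge d.w d.w), var (d.P.c d.w), var (d.Q.c d.w), var (d.T.ge (d.w + 1) d.w),
      var (d.T.ny d.w), var (d.T.ge (d.w + 1) (d.w + 1))]) rfl
    (FregeSystem.prems_cons (Or.inr (d.mem_lines K le_rfl)) (FregeSystem.prems_cons (Or.inl hnt)
      (FregeSystem.prems_cons (Or.inl hct) (FregeSystem.prems_cons (Or.inl hlt) FregeSystem.prems_nil))))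

/-- Size of the monotonicity laws. [folklore] -/
theorem proofSize_mono (d : MonoData) (K : PropForm ℕ) (v : ℕ) :
    proofSize (d.lines K ++ [ctx K (neg (var v))]) ≤ (d.w + 2) * (K.size + 55) := by
  rw [proofSize_append, proofSize_singleton, Nat.succ_mul]
  refine Nat.add_le_add (d.proofSize_lines K) ?_
  simp [ctx, size]

end MonoData

/-! ### Law: `x + z ≥ z` -/

/-- The data of `x + z ≥ z`: the adder `P = x + z` and the comparator `T = (P, z)` on `w + 1`
bits (`z` padded by the `⊥` variable `f`). [folklore] -/
structure GeData where
  /-- base of `P` -/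
  bP : ℕ
  /-- base of `T` -/
  bT : ℕ
  /-- first word -/
  x : ℕ → ℕ
  /-- second word -/
  z : ℕ → ℕ
  /-- a `⊥` variable -/
  f : ℕ
  /-- width -/
  w : ℕ

namespace GeData

/-- `P = x + z`. [folklore] -/
def P (d : GeData) : Adder.View := ⟨d.bP, d.x, d.z⟩
/-- `T` compares `x + z` with `z` (`w + 1` bits). [folklore] -/
def T (d : GeData) : View := ⟨d.bT, Adder.extOut d.P d.w, Adder.zext d.z d.f d.w⟩

/-- The lines: `geᵢ(T) ↔ ¬cᵢ(P)` for `i ≤ w`, then `ge(T)` at `w + 1`. [folklore] -/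
def line (d : GeData) (K : PropForm ℕ) (k : ℕ) : PropForm ℕ :=
  if k = d.w + 1 then ctx K (var (d.T.ge (d.w + 1) (d.w + 1)))
  else ctx K (biimp (var (d.T.ge (d.w + 1) k)) (neg (var (d.P.c k))))

/-- The block. [folklore] -/
def lines (d : GeData) (K : PropForm ℕ) : List (PropForm ℕ) := (List.range (d.w + 2)).map (d.line K)

/-- Invariant positions. [folklore] -/
theorem line_inv (d : GeData) (K : PropForm ℕ) {k : ℕ} (hk : k ≤ d.w) :
    d.line K k = ctx K (biimp (var (d.T.ge (d.w + 1) k)) (neg (var (d.P.c k)))) := by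
  rw [line, if_neg (by omega)]

/-- **`x + z ≥ z` inside Frege**: the comparator of `x + z` (as a `w+1`-bit word) with `z`
(zero-extended by the provably false `f`) provably answers `≥`. [cite: CookReckhow1979, §2] -/
theorem isBlock_lines (hG : ∀ r ∈ orderRules, r ∈ G.rules) (d : GeData) (hP : d.P.Avail K Γ false d.w)
    (hT : d.T.Avail K Γ (d.w + 1)) (hf : ctx K (neg (var d.f)) ∈ Γ) : G.IsBlock Γ (d.lines K) := by
  refine isBlock_map_range (d.w + 2) fun k hk => Or.inr ?_
  by_cases hend : k = d.w + 1
  · subst hend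
    rw [line, if_pos rfl]
    have hnt := hT.1 d.w (Nat.lt_succ_self _)
    have hct := (hT.2.2 d.w (Nat.lt_succ_self _)).2
    rw [View.notDef, show d.T.y d.w = d.f from Adder.zext_top d.z d.f d.w] at hnt
    rw [Adder.View.carryDef, show (d.T.adder (d.w + 1)).x d.w = d.P.c d.w from Adder.extOut_top d.P d.w]
      at hct
    exact FregeSystem.IsInferredFrom.of_rule (hG _ mem_orderRules.2.2.2.2.2.2.2.2.2.1)
      (FregeSystem.sub [K, var (d.T.ge (d.w + 1) d.w), var (d.P.c d.w), var d.f, var (d.T.ny d.w),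
        var (d.T.ge (d.w + 1) (d.w + 1))]) rfl
      (FregeSystem.prems_cons (Or.inr ⟨d.w, by omega, (d.line_inv K le_rfl).symm⟩)
        (FregeSystem.prems_cons (Or.inl hf) (FregeSystem.prems_cons (Or.inl hnt)
        (FregeSystem.prems_cons (Or.inl hct) FregeSystem.prems_nil))))
  rcases k with _ | k
  · rw [d.line_inv K (Nat.zero_le _)]
    exact FregeSystem.IsInferredFrom.of_rule (hG _ mem_orderRules.2.2.2.2.2.2.2.1)
      (FregeSystem.sub [K, var (d.T.ge (d.w + 1) 0), var (d.P.c 0)]) rfl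
      (FregeSystem.prems_cons (Or.inl hT.2.1) (FregeSystem.prems_cons (Or.inl hP.1) FregeSystem.prems_nil))
  · have hk' : k < d.w := by omega
    rw [d.line_inv K (by omega)]
    have hnt := hT.1 k (by omega)
    have hct := (hT.2.2 k (by omega)).2
    rw [View.notDef, show d.T.y k = d.z k from Adder.zext_lt d.z d.f hk'] at hnt
    rw [Adder.View.carryDef, show (d.T.adder (d.w + 1)).x k = d.P.s k from Adder.extOut_lt d.P hk']
      at hct
    exact FregeSystem.IsInferredFrom.of_rule (hG _ mem_orderRules.2.2.2.2.2.2.2.2.1)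
      (FregeSystem.sub [K, var (d.T.ge (d.w + 1) k), var (d.P.c k), var (d.x k), var (d.z k),
        var (d.P.s k), var (d.T.ny k), var (d.T.ge (d.w + 1) (k + 1)), var (d.P.c (k + 1))]) rfl
      (FregeSystem.prems_cons (Or.inr ⟨k, by omega, (d.line_inv K hk'.le).symm⟩)
        (FregeSystem.prems_cons (Or.inl (hP.2 k hk').1) (FregeSystem.prems_cons (Or.inl hnt)
        (FregeSystem.prems_cons (Or.inl hct) (FregeSystem.prems_cons (Or.inl (hP.2 k hk').2)
        FregeSystem.prems_nil)))))

/-- Conclusion: `x + z ≥ z`. [folklore] -/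
theorem mem_lines (d : GeData) (K : PropForm ℕ) : ctx K (var (d.T.ge (d.w + 1) (d.w + 1))) ∈ d.lines K := by
  have := mem_map_range (line := d.line K) (show d.w + 1 < d.w + 2 by omega)
  rwa [line, if_pos rfl] at this

/-- Size of the law. [folklore] -/
theorem proofSize_lines (d : GeData) (K : PropForm ℕ) : proofSize (d.lines K) ≤ (d.w + 2) * (K.size + 12) :=
  proofSize_map_range_le fun k _ => by
    unfold line
    split_ifs <;> simp [ctx, size, FregeSystem.size_biimp]

end GeData

/-! ### Law: the top bit under a strict comparison with a zero-extended word -/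

/-- **Top bit inside Frege**: if `x < y` on `w + 1` bits (comparator `S`) and the top bit of
`y` is provably false, then the top bit of `x` is provably false and the low `w` bits compare
strictly as well (`¬ge(w)` of `S`): two inferences. [cite: CookReckhow1979, §2] -/
theorem isBlock_topBit (hG : ∀ r ∈ orderRules, r ∈ G.rules) (S : View) (hS : S.Avail K Γ (w + 1))
    (hy : ctx K (neg (var (S.y w))) ∈ Γ) (hlt : ctx K (neg (var (S.ge (w + 1) (w + 1)))) ∈ Γ) :
    G.IsBlock Γ [ctx K (neg (var (S.x w))), ctx K (neg (var (S.ge (w + 1) w)))] := by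
  have hn := hS.1 w (Nat.lt_succ_self w)
  have hc := (hS.2.2 w (Nat.lt_succ_self w)).2
  refine FregeSystem.IsBlock.cons (Or.inr ?_) (FregeSystem.IsBlock.singleton (Or.inr ?_))
  · exact FregeSystem.IsInferredFrom.of_rule (hG _ mem_orderRules.2.2.2.2.2.2.2.2.2.2.1)
      (FregeSystem.sub [K, var (S.y w), var (S.ny w), var (S.ge (w + 1) (w + 1)), var (S.x w),
        var (S.ge (w + 1) w)]) rfl
      (FregeSystem.prems_cons hy (FregeSystem.prems_cons hn (FregeSystem.prems_cons hc
        (FregeSystem.prems_cons hlt FregeSystem.prems_nil))))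
  · exact FregeSystem.IsInferredFrom.of_rule (hG _ mem_orderRules.2.2.2.2.2.2.2.2.2.2.2)
      (FregeSystem.sub [K, var (S.y w), var (S.ny w), var (S.ge (w + 1) (w + 1)), var (S.x w),
        var (S.ge (w + 1) w)]) rfl
      (FregeSystem.prems_cons (Or.inl hy) (FregeSystem.prems_cons (Or.inl hn) (FregeSystem.prems_cons
        (Or.inl hc) (FregeSystem.prems_cons (Or.inl hlt) FregeSystem.prems_nil))))

/-! ### Law: congruence (Leibniz) for subtractor views -/

/-- The lines of the congruence law for subtractors: first the complement gates (`w` lines),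
then the inner adders wire by wire (`2w + 1` lines). [folklore] -/
def leibLines (S T : View) (K : PropForm ℕ) (w : ℕ) : List (PropForm ℕ) :=
  (List.range w).map (fun j => ctx K (eqv (S.ny j) (T.ny j))) ++ Adder.leibLines (S.adder w) (T.adder w) K w

/-- **Congruence of subtraction/comparison inside Frege**: two subtractors with provably equal
operands have provably equal complement gates, difference bits and comparison carries.
[cite: CookReckhow1979, §2] -/
theorem isBlock_leibLines (hGN : ∀ r ∈ Netlist.rules, r ∈ G.rules) (hGL : ∀ r ∈ Logic.rules, r ∈ G.rules)
    (S T : View) (hS : S.Avail K Γ w) (hT : T.Avail K Γ w)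
    (hx : ∀ i < w, ctx K (eqv (S.x i) (T.x i)) ∈ Γ) (hy : ∀ i < w, ctx K (eqv (S.y i) (T.y i)) ∈ Γ) :
    G.IsBlock Γ (leibLines S T K w) := by
  refine (Scaffold.isBlock_of_forall fun θ hθ => ?_).append ?_
  · obtain ⟨j, hj, rfl⟩ := List.mem_map.1 hθ
    rw [List.mem_range] at hj
    exact Or.inr (Logic.infer hGL 17 (by decide) (FregeSystem.sub [K, var (S.ny j), var (S.y j), var (T.ny j), var (T.y j)])
      rfl (FregeSystem.prems_cons (hS.1 j hj) (FregeSystem.prems_cons (hT.1 j hj)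
        (FregeSystem.prems_cons (hy j hj) FregeSystem.prems_nil))))
  · exact Adder.isBlock_leibLines hGN (S.adder w) (T.adder w) (hS.2.mono Set.subset_union_left)
      (hT.2.mono Set.subset_union_left) (fun i hi => Or.inl (hx i hi))
      fun i hi => Or.inr (List.mem_map.2 ⟨i, List.mem_range.2 hi, rfl⟩)

/-- Conclusions of the congruence law: the comparison carries (in particular `ge`) and the
difference bits of the two subtractors are provably equal (every inner adder wire `k ≤ 2w`).
[folklore] -/
theorem mem_leibLines {S T : View} {K : PropForm ℕ} {w k : ℕ} (hk : k < 2 * w + 1) :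
    ctx K (eqv ((S.adder w).wire k) ((T.adder w).wire k)) ∈ leibLines S T K w :=
  List.mem_append_right _ (Adder.mem_leibLines hk)

/-- Size of the congruence law. [folklore] -/
theorem proofSize_leibLines (S T : View) (K : PropForm ℕ) (w : ℕ) :
    proofSize (leibLines S T K w) ≤ (3 * w + 1) * (K.size + 10) := by
  rw [leibLines, proofSize_append]
  have h₁ : proofSize ((List.range w).map fun j => ctx K (eqv (S.ny j) (T.ny j))) ≤ w * (K.size + 10) :=
    proofSize_map_range_le fun j _ => by simp [ctx, eqv, size, FregeSystem.size_biimp]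
  have h₂ := Adder.proofSize_leibLines (S.adder w) (T.adder w) K w
  nlinarith [h₁, h₂]

end Sub

end Literature.Computability.MetaComplexity
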